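import Literature.NumberTheory.Automorphic.FLSResidualImageCriteria
import HarnessLib

/-!
# Kisin 2009, hypothesis (3.2.3)(3) = (3.5.5)(3) = (3.5.7)(4): the extra Taylor–Wiles condition at
# `p = 5`, and its vacuity for representations of square determinant (e.g. `ρ̄_{E,5}` over `K ∋ √5`)

Topic `Literature/NumberTheory/Automorphic` (modularity lifting for `GL₂` over totally real fields;
companion of `FLSResidualImageCriteria.lean`, `FreitasLeHungSiksekLifting.lean` — the named facts
`FLS2015_theorem3`, `FLS2015_theorems3_4` — and of `CartanNormalizerCriterionGaloisImage.lean`,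
whose group form of Caraiani–Newton's Lemma 6.1.4 (`CaraianiNewton.exists_projective_eq_one_det_ne_one`)
is the `ζ₅ ∉ F` sibling of the present file).  Typed for the cell `pub/lg-quartmod` (F-L1:
modularity of elliptic curves over totally real quartic fields CONTAINING `√5`), whose referee gate
(`pub/gate-quartmod`, 2026-08-25, verdict GO) turned on exactly this clause of Kisin's theorem.

**Nothing in this file proves a modularity statement.**  It types ONE printed HYPOTHESIS of a
modularity lifting theorem as a definition, proves the printed gloss on it, and proves that the
hypothesis is automatically satisfied by every mod-`5` representation whose determinant takes
only square values — in particular by `ρ̄_{E,5}` for every elliptic curve `E` over a field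
`K ∋ √5` (where `det ρ̄_{E,5} = χ̄₅ ∈ {±1}`, Freitas–Le Hung–Siksek 2015, Remark (iii) after
Cor. 2.1).  No named fact is introduced (D-0026): definitions and theorems only.

## What the source prints (held text `paper:doi-10-4007-annals-2009-170-1085`)

M. Kisin, *Moduli of finite flat group schemes, and modularity*, Ann. of Math. (2) 170 (2009)
1085–1180 [KisinModuli2009].  Standing: `p > 2` (Introduction, p. 1086: "Let `p > 2` be a
prime"), `F` totally real (§3), `ρ̄ : G_{F,S} → GL₂(𝔽)` the reduction of `ρ`.

* **(3.2.3)** (p. 1154–1155): "We now specialize to the case where `dim_𝔽 V_𝔽 = 2`, and we will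
  make the following assumptions. (1) `ρ̄` is unramified outside the primes of `F` dividing `p`,
  and has odd determinant. (2) The restriction of `ρ̄` to `G_{F(ζ_p)}` is absolutely irreducible.
  **(3) If `p = 5`, and `ρ̄` has projective image isomorphic to `PGL₂(𝔽₅)`, then the kernel of
  `proj ρ̄` does not fix `F(ζ₅)`.³  This condition holds if `[F(ζ₅) : F] = 4`.** (4) If
  `v ∈ S ∖ Σ_p`, then `(1 − N(v))((1 + N(v))² det ρ̄(Frob_v) − N(v)(tr ρ̄(Frob_v))²) ∈ 𝔽^×`."
  Footnote 3: "We thank the referee for pointing out that an assumption on `F(ζ_p)` is needed only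
  in this special case."  Then: "Note that (2) is equivalent to asking that `ρ̄` remain absolutely
  irreducible when restricted to the unique quadratic extension of `F` contained in `F(ζ_p)`."
  Where it is used (proof of Prop. (3.2.5), p. 1155): "This uses the conditions (2) and (3)
  introduced in (3.2.3) above, the latter condition being needed only to apply [DDT, 2.47]" —
  the existence of Taylor–Wiles primes.
* **Theorem (3.5.5)** (p. 1170): "Let `ρ : G_{F,S} → GL₂(E)` be a continuous representation, which
  satisfies the following conditions: (1) `ρ` is strongly residually modular. (2) If `𝔭 ∣ p`, and
  `ρ|_{G_{F_𝔭}}` is not potentially ordinary, then the residue field of `𝔭` is `𝔽_p`. (3) The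
  restriction of `ρ̄` to `G_{F(ζ_p)}` is absolutely irreducible. If `p = 5`, and `ρ̄` has projective
  image isomorphic to `PGL₂(𝔽₅)`, then the kernel of `proj ρ̄` does not fix `F(ζ₅)`. Then `ρ` is
  modular. That is, `ρ ≃ ρ_{g,λ}` for some Hilbert modular form `g`."  (Footnote 5: "After the
  writing of this paper was completed Toby Gee was able to prove (2.5.6) for `ρ̄` with trivial image
  […]. This allows one to remove the condition (2).")
* **Theorem (3.5.7)** (p. 1172): "Let `ρ : G_{F,S} → GL₂(E)` be a continuous representation, and
  suppose that: (1) `det ρ` is equal to the cyclotomic character times a character of finite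
  order. (2) For all primes `𝔭` of `F` dividing `p`, `ρ|_{G_{F_𝔭}}` is potentially Barsotti–Tate and
  not potentially ordinary, and the residue field at `𝔭` is equal to `𝔽_p`.⁶ (3) `ρ̄ ≃ ρ̄_{f,λ}` for
  a Hilbert modular form `f` over `F` of parallel weight `2`. (4) `ρ̄|_{G_{F(ζ_p)}}` is absolutely
  irreducible. If `p = 5` and `ρ̄` has projective image isomorphic to `PGL₂(𝔽₅)`, then the kernel
  of `proj ρ̄` does not fix `F(ζ_p)`. Then `ρ ≃ ρ_{g,λ}` for some Hilbert modular form `g`."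
  (Footnote 6: "Again, the results of Gee make the last assumption unnecessary.")

**Deliberately NOT vendored.**  Theorems (3.5.5) and (3.5.7) themselves are not restated as named
facts: (a) no consumer — the elliptic-curve packaging that the totally-real-modularity files of the
tree consume is Freitas–Le Hung–Siksek 2015, Thm. 2/3 (via Breuil–Diamond, Thm. 3.2.2, which
absorbs Kisin, Gee and Barnet-Lamb–Gee–Geraghty), already typed as `FLS2015_theorem3` /
`FLS2015_theorems3_4` and, for Thm. 2, written out as a hypothesis in
`FLSThreeFiveSwitchingProofs.lean`; (b) hypothesis (2) ("not potentially ordinary", residue field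
`𝔽_p`) has no carrier in the tree.  Route `Langlands/SqrtFiveQuarticCovers` cites
[KisinModuli2009] only for the clause typed here.

**The F-L1 point, as printed by Freitas–Le Hung–Siksek** (Invent. Math. 201 (2015), §2, proof of
their Thm. 2, held text `paper:arxiv-1310.7088` p. 8): "When `p = 5`, the theorem [Breuil–Diamond,
Thm. 3.2.2] has an extra hypothesis: namely that the projective image of `ρ̄|_{G_{K(ζ₅)}}` is not
`PSL₂(𝔽₅)`. The reason for this additional hypothesis is to assure the existence of Taylor–Wiles
systems (as in [Kisin]). However, in our situation, because `det ρ̄` is the mod `5` cyclotomic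
character, we can still choose Taylor–Wiles systems without this extra condition […] Suppose the
above happens, then `√5 ∈ K` […] But `ζ₅ ∈ K₀ ∖ K` implies that `Gal(K₀/K)` has a quotient of order
`2`. As `Gal(K₀/K) ≅ PSL₂(𝔽₅) ≅ A₅`, we have a contradiction."  Accordingly FLS Thms. 2–4 carry NO
condition at `p = 5` (`FLS2015_theorem3`: "Let `p = 3` or `5` … `ρ̄_{E,p}(G_{K(ζ_p)})` absolutely
irreducible. Then `E` is modular").  The theorems of this file record the elementary half of that
discussion in KISIN's formulation: when `det ρ̄ ⊆ (𝔽₅ˣ)²` — e.g. `det ρ̄ = χ̄₅` and `√5 ∈ K`, so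
that `χ̄₅(Γ_K) = Gal(K(ζ₅)/K) ↪ {±1}` — the projective image of `ρ̄(Γ_K)` lies in the image of the
square-determinant matrices, a proper subgroup of `PGL₂(𝔽₅)`, so it is never "isomorphic to
`PGL₂(𝔽₅)`" and Kisin's clause (3) holds vacuously (`Kisin2009.taylorWilesHypothesisFive_of_isSquare_det`,
`Kisin2009.hypothesisFive_of_isSquare_five`).  And Freitas–Le Hung–Siksek, Remark (iii) after
Cor. 2.1 (held text p. 20): "let `K = ℚ(√5)`. Let `G = ρ̄(G_K)` where `ρ̄ = ρ̄_{E,5}` […] Then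
`det(G) = χ₅(Gal(ℚ(ζ₅)/ℚ(√5))) = {1̄, 4̄} ⊂ 𝔽₅^*`" — here for every field of characteristic `0`
containing `√5` (`modPCyclotomicCharacterZMod_five_sq_eq_one_of_isSquare`,
`det_sq_eq_one_of_isTorsionGaloisRep_of_isSquare_five`).

## Rendering (read before citing)

* `ρ̄ : G_F → GL₂(𝔽₅)` ⟶ any group homomorphism `ρ : Γ →* GL (Fin 2) (ZMod 5)` (group form), resp. a
  framed mod-`5` Galois representation `FramedGaloisRep K (ZMod 5) 2` (its `toMonoidHom`).
* "`proj ρ̄`" ⟶ `Matrix.ProjGenLinGroup.mk ∘ ρ̄ : Γ → PGL₂(𝔽₅)` (Mathlib's `PGL(2, 𝔽₅) = GL₂ ⧸ Z`).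
  "`ρ̄` has projective image isomorphic to `PGL₂(𝔽₅)`" ⟶ `proj ρ̄` is ONTO: the projective image is
  a subgroup of the finite group `PGL₂(𝔽₅)`, and a subgroup of a finite group abstractly
  isomorphic to the whole group is the whole group (`Kisin2009.surjective_of_nonempty_mulEquiv`,
  proved; the converse `…nonempty_mulEquiv_of_surjective` too).
* "the kernel of `proj ρ̄` does not fix `F(ζ₅)`" ⟶ some `γ` with `proj ρ̄(γ) = 1` acts
  non-trivially on `ζ₅`, i.e. has `χ̄₅(γ) ≠ 1` for the mod-`5` cyclotomic character
  `χ̄₅ = modPCyclotomicCharacterZMod K 5 : Γ_K →* 𝔽₅ˣ` (`σ ζ = ζ^{χ̄₅(σ)}`; `ker χ̄₅ = Γ_{K(ζ₅)}`),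
  resp. `χ γ ≠ 1` for an abstract character `χ : Γ →* 𝔽₅ˣ` in the group form.
* "`[F(ζ₅) : F] = 4`" ⟶ `χ̄₅` onto `𝔽₅ˣ` (`Gal(F(ζ₅)/F) ≅ χ̄₅(Γ_F)`), as in
  `FLSResidualImageCriteria.lean` ("`K ∩ ℚ(ζ_p) = ℚ`" ⟶ `Function.Surjective (modPCyclotomicCharacterZMod K p)`).
* "`√5 ∈ K`" ⟶ `IsSquare (5 : K)` (as in `Box2022_theorem1_1`).

## Contents (all proved; no `sorry`, no new `Prop`-valued fact)

* `Kisin2009.TaylorWilesHypothesisFive ρ χ` (group form) and `Kisin2009.hypothesisFive K ρ̄`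
  (Galois form, `χ = χ̄₅`) — hypothesis (3.2.3)(3), a DEFINITION.
* `Kisin2009.surjective_of_nonempty_mulEquiv`, `Kisin2009.nonempty_mulEquiv_of_surjective` — the
  rendering of "projective image isomorphic to `PGL₂(𝔽₅)`" as surjectivity of `proj ρ̄`.  (Finite
  checks in `𝔽₅` are `private` helpers.)
* `Kisin2009.not_surjective_proj_of_isSquare_det` — if every `det ρ(γ)` is a square in `𝔽₅ˣ`, then
  `proj ρ` is not onto `PGL₂(𝔽₅)` (the class of `diag(2, 1)` is missed: `2` is not a square mod `5`);
  `Kisin2009.taylorWilesHypothesisFive_of_isSquare_det` — hence (3) holds.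
* `Kisin2009.taylorWilesHypothesisFive_of_surjective` — **the printed gloss "This condition holds if
  `[F(ζ₅) : F] = 4`"**, in group form: if `χ` is onto `𝔽₅ˣ` then (3) holds.  Proof (the source
  gives none; standard): if `proj ρ` is onto and its kernel lies in `ker χ`, then every `χ(γ)²` is
  `1` — because `ρ(γ)² = det ρ(γ) · s` with `s ∈ SL₂(𝔽₅) = [SL₂(𝔽₅), SL₂(𝔽₅)]` (Mathlib
  `Matrix.SL2.commutator_eq_top`), and commutators of `GL₂(𝔽₅) = ρ(Γ) · Z` are values of `ρ` on
  commutators of `Γ`, killed by `χ` — contradicting `χ` onto (`2² ≠ 1`).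
* `modPCyclotomicCharacterZMod_five_sq_eq_one_of_isSquare` — `√5 ∈ K` (char. `0`) ⇒ `χ̄₅(σ)² = 1`
  for all `σ ∈ Γ_K` (the Gauss sum `g = ζ + ζ⁴ − ζ² − ζ³`, `g² = 5`, lies in `K`, and `σ` with
  `χ̄₅(σ) ∈ {2, 3}` sends `g ↦ −g`); the converse direction of the tree's
  `modPCyclotomicCharacterZMod_five_surjective` (`√5 ∉ K` ⇒ `χ̄₅` onto).
* `det_sq_eq_one_of_isTorsionGaloisRep_of_isSquare_five` — FLS Remark (iii): for `E / K` elliptic,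
  `√5 ∈ K`, every framing `ρ̄` of `E[5]` has `det ρ̄(σ)² = 1`, i.e. `det ρ̄(σ) = ±1`
  (`det ρ̄ = χ̄₅`: `WeierstrassCurve.det_eq_modPCyclotomicCharacter_of_isTorsionGaloisRep_holds`).
* `Kisin2009.not_surjective_proj_of_isTorsionGaloisRep_of_isSquare_five`,
  `Kisin2009.hypothesisFive_of_isSquare_five` — for `E / K` elliptic with `√5 ∈ K` the projective
  image of `ρ̄_{E,5}` is never all of `PGL₂(𝔽₅)`, and Kisin's clause (3) holds for every framing:
  the referee gate's deciding line, as a theorem.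

## References

* [KisinModuli2009] M. Kisin, Ann. of Math. (2) 170 (2009) 1085–1180, doi:10.4007/annals.2009.170.1085:
  Introduction (Theorem, p. 1086), (3.2.3) with footnote 3 and proof of (3.2.5) (pp. 1154–1155),
  Thm. (3.5.5) with footnote 5 (p. 1170), Thm. (3.5.7) with footnote 6 (p. 1172) — held text pp. 4,
  72–73, 88, 90.
* [FreitasLeHungSiksek2015] Invent. Math. 201 (2015) 159–206 = arXiv:1310.7088: §2 (proof of
  Thm. 2, the `p = 5` paragraph; held text p. 8), Thm. 3 (p. 4), Remark (iii) after Cor. 2.1 =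
  published Cor. 10.1 (held text p. 20).
* [CaraianiNewton2023] Lemma 6.1.4 (the `ζ₅ ∉ F` sibling; tree
  `CartanNormalizerCriterionGaloisImage.lean`); [DDT] H. Darmon, F. Diamond, R. Taylor, *Fermat's
  Last Theorem*, Thm. 2.49 and Lemma 2.47 (where the condition enters, as cited by Kisin).
-/

open scoped MatrixGroups
open Matrix Field Literature.NumberTheory.GaloisRepresentations

noncomputable section

namespace Literature.NumberTheory.Automorphic

namespace Kisin2009

universe u

variable {Γ : Type u} [Group Γ]

/-! ### The hypothesis (group form) -/

/-- **Kisin 2009, hypothesis (3.2.3)(3)** (= Thm. (3.5.5), hypothesis (3), second sentence =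
Thm. (3.5.7), hypothesis (4), second sentence), group form: "If `p = 5`, and `ρ̄` has projective
image isomorphic to `PGL₂(𝔽₅)`, then the kernel of `proj ρ̄` does not fix `F(ζ₅)`."  For a
homomorphism `ρ : Γ →* GL₂(𝔽₅)` and a character `χ : Γ →* 𝔽₅ˣ` (in the source `Γ = G_{F,S}`,
`χ = χ̄₅` the mod-`5` cyclotomic character, so that "fixes `F(ζ₅)`" = "lies in `ker χ̄₅`"): IF
`proj ρ = (GL₂ → PGL₂) ∘ ρ` is onto `PGL₂(𝔽₅)` (⟺ the projective image is isomorphic to `PGL₂(𝔽₅)`,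
`surjective_of_nonempty_mulEquiv` / `nonempty_mulEquiv_of_surjective`), THEN some `γ` in the
kernel of `proj ρ` (i.e. with scalar `ρ(γ)`) has `χ(γ) ≠ 1`.  The condition that makes
Taylor–Wiles primes exist at `p = 5` ([DDT, 2.47], proof of Kisin's (3.2.5)).
[cite: KisinModuli2009, (3.2.3)(3) (p. 1155) and Thms. (3.5.5)(3), (3.5.7)(4)] -/
def TaylorWilesHypothesisFive (ρ : Γ →* GL (Fin 2) (ZMod 5)) (χ : Γ →* (ZMod 5)ˣ) : Prop :=
  Function.Surjective (Matrix.ProjGenLinGroup.mk.comp ρ) →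
    ∃ γ : Γ, Matrix.ProjGenLinGroup.mk (ρ γ) = 1 ∧ χ γ ≠ 1

/-- Unfolding lemma for `TaylorWilesHypothesisFive` (the definition, restated).
[cite: KisinModuli2009, (3.2.3)(3)] -/
theorem taylorWilesHypothesisFive_iff (ρ : Γ →* GL (Fin 2) (ZMod 5)) (χ : Γ →* (ZMod 5)ˣ) :
    TaylorWilesHypothesisFive ρ χ ↔
      (Function.Surjective (Matrix.ProjGenLinGroup.mk.comp ρ) →
        ∃ γ : Γ, Matrix.ProjGenLinGroup.mk (ρ γ) = 1 ∧ χ γ ≠ 1) :=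
  Iff.rfl

/-- The hypothesis holds trivially when the projective image is NOT all of `PGL₂(𝔽₅)` (the only
case in which Kisin asks anything is "projective image isomorphic to `PGL₂(𝔽₅)`").
[cite: KisinModuli2009, (3.2.3)(3)] -/
theorem taylorWilesHypothesisFive_of_not_surjective {ρ : Γ →* GL (Fin 2) (ZMod 5)}
    (χ : Γ →* (ZMod 5)ˣ) (h : ¬ Function.Surjective (Matrix.ProjGenLinGroup.mk.comp ρ)) :
    TaylorWilesHypothesisFive ρ χ :=
  fun hs => absurd hs h

/-! ### "projective image isomorphic to `PGL₂(𝔽₅)`" = "`proj ρ` onto" -/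

/-- `PGL₂(𝔽₅)` is finite (a quotient of the finite group `GL₂(𝔽₅)`). [folklore] -/
private theorem finite_PGL_two_five : Finite PGL(2, ZMod 5) := by
  unfold Matrix.ProjGenLinGroup
  infer_instance

/-- If the projective image `proj ρ(Γ) ≤ PGL₂(𝔽₅)` is (abstractly) isomorphic to `PGL₂(𝔽₅)`, then
`proj ρ` is onto — a subgroup of a finite group with the cardinality of the group is everything.
This justifies rendering Kisin's "projective image isomorphic to `PGL₂(𝔽₅)`" by surjectivity.
[cite: KisinModuli2009, (3.2.3)(3) ("projective image isomorphic to PGL₂(𝔽₅)")] -/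
theorem surjective_of_nonempty_mulEquiv {ρ : Γ →* GL (Fin 2) (ZMod 5)}
    (h : Nonempty ((Matrix.ProjGenLinGroup.mk.comp ρ).range ≃* PGL(2, ZMod 5))) :
    Function.Surjective (Matrix.ProjGenLinGroup.mk.comp ρ) := by
  haveI := finite_PGL_two_five
  obtain ⟨e⟩ := h
  have htop : (Matrix.ProjGenLinGroup.mk.comp ρ).range = ⊤ := by
    apply Subgroup.eq_top_of_card_eq
    exact Nat.card_congr e.toEquiv
  exact MonoidHom.range_eq_top.mp htop

/-- Conversely, if `proj ρ` is onto then its range is isomorphic to `PGL₂(𝔽₅)` — so the two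
readings of "projective image isomorphic to `PGL₂(𝔽₅)`" agree.
[cite: KisinModuli2009, (3.2.3)(3) ("projective image isomorphic to PGL₂(𝔽₅)")] -/
theorem nonempty_mulEquiv_of_surjective {ρ : Γ →* GL (Fin 2) (ZMod 5)}
    (h : Function.Surjective (Matrix.ProjGenLinGroup.mk.comp ρ)) :
    Nonempty ((Matrix.ProjGenLinGroup.mk.comp ρ).range ≃* PGL(2, ZMod 5)) :=
  ⟨(MulEquiv.subgroupCongr (MonoidHom.range_eq_top.mpr h)).trans Subgroup.topEquiv⟩

/-! ### Square determinant ⇒ the projective image is proper ⇒ the hypothesis holds -/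

/-- `2` is not a square in `𝔽₅` (the squares are `0, 1, 4`). [folklore] -/
private theorem not_isSquare_two_zmod5 : ¬ IsSquare (2 : ZMod 5) := by decide

/-- **If every `det ρ(γ)` is a square in `𝔽₅ˣ`, the projective image of `ρ` is a proper subgroup
of `PGL₂(𝔽₅)`**: the class of `diag(2, 1)` is not a value of `proj ρ`, since `proj ρ(γ) = proj D`
means `ρ(γ) · u = D` for a scalar `u`, whence `2 = det D = det ρ(γ) · u²` would be a square.  (The
projective image lies in the image of `GL₂⁺(𝔽₅) = {det ∈ (𝔽₅ˣ)²}`, which is `PSL₂(𝔽₅)`, of index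
`2`.)  This is the mechanism behind Freitas–Le Hung–Siksek's remark that for cyclotomic
determinant and `√5 ∈ K` the projective image lies in `PSL₂(𝔽₅)`. [cite: FreitasLeHungSiksek2015, §2 (proof of Thm. 2, p = 5)] -/
theorem not_surjective_proj_of_isSquare_det {ρ : Γ →* GL (Fin 2) (ZMod 5)}
    (h : ∀ γ : Γ, IsSquare (Matrix.GeneralLinearGroup.det (ρ γ))) :
    ¬ Function.Surjective (Matrix.ProjGenLinGroup.mk.comp ρ) := by
  intro hs
  set D : GL (Fin 2) (ZMod 5) := ⟨!![2, 0; 0, 1], !![3, 0; 0, 1], by decide, by decide⟩ with hD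
  obtain ⟨γ, hγ⟩ := hs (Matrix.ProjGenLinGroup.mk D)
  rw [MonoidHom.comp_apply] at hγ
  obtain ⟨u, hu⟩ := Matrix.ProjGenLinGroup.mk_eq_mk_iff.mp hγ
  obtain ⟨r, hr⟩ := h γ
  have hdet := congrArg (fun g : GL (Fin 2) (ZMod 5) => (Matrix.GeneralLinearGroup.det g : ZMod 5)) hu
  simp only [map_mul, Matrix.GeneralLinearGroup.det_scalar, Fintype.card_fin, Units.val_mul,
    Units.val_pow_eq_pow_val, hr] at hdet
  have hD2 : (Matrix.GeneralLinearGroup.det D : ZMod 5) = 2 := by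
    rw [Matrix.GeneralLinearGroup.val_det_apply, hD, Matrix.det_fin_two_of]; ring
  rw [hD2] at hdet
  exact not_isSquare_two_zmod5 ⟨(r : ZMod 5) * (u : ZMod 5), by rw [← hdet]; ring⟩

/-- **Kisin's hypothesis (3.2.3)(3) holds for every `ρ` of square determinant**, whatever the
character `χ` — vacuously, the projective image being proper
(`not_surjective_proj_of_isSquare_det`). [cite: KisinModuli2009, (3.2.3)(3)] -/
theorem taylorWilesHypothesisFive_of_isSquare_det {ρ : Γ →* GL (Fin 2) (ZMod 5)}
    (χ : Γ →* (ZMod 5)ˣ) (h : ∀ γ : Γ, IsSquare (Matrix.GeneralLinearGroup.det (ρ γ))) :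
    TaylorWilesHypothesisFive ρ χ :=
  taylorWilesHypothesisFive_of_not_surjective χ (not_surjective_proj_of_isSquare_det h)

/-! ### Kisin's gloss: "This condition holds if `[F(ζ₅) : F] = 4`" -/

/-- A convenient unit of `𝔽₅`: `2`, with inverse `3` (plumbing). [folklore] -/
private def twoUnit : (ZMod 5)ˣ := ⟨2, 3, by decide, by decide⟩

/-- `2² = 4 ≠ 1` in `𝔽₅ˣ`. [folklore] -/
private theorem twoUnit_sq_ne_one : twoUnit ^ 2 ≠ 1 := by decide

/-- The units of `𝔽₅` of square `1` are `±1` (finite check, stated here — outside any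
`Fact (Nat.Prime 5)` context — so that `decide` sees closed terms). [folklore] -/
private theorem units_zmod5_eq_or_eq_neg_of_sq_eq_one : ∀ u : (ZMod 5)ˣ, u ^ 2 = 1 → u = 1 ∨ u = -1 := by
  decide

/-- Same, on the underlying elements of `𝔽₅`. [folklore] -/
private theorem units_zmod5_val_eq_or_eq_neg_of_sq_eq_one :
    ∀ u : (ZMod 5)ˣ, u ^ 2 = 1 → (u : ZMod 5) = 1 ∨ (u : ZMod 5) = -1 := by
  decide

/-- Units of `𝔽₅` of square `1` are squares (`1 = 1²`, `-1 = 2²`). [folklore] -/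
private theorem units_zmod5_isSquare_of_sq_eq_one : ∀ u : (ZMod 5)ˣ, u ^ 2 = 1 → IsSquare u := by
  decide

/-- `1² = 1` and `4² = 1` in `𝔽₅` (closed-term finite checks). [folklore] -/
private theorem natCast_sq_eq_one_zmod5 : ((1 : ℕ) : ZMod 5) ^ 2 = 1 ∧ ((4 : ℕ) : ZMod 5) ^ 2 = 1 := by
  decide

/-- **If `proj ρ` is onto and its kernel lies in `ker χ`, then `χ² = 1`.**  The character `χ`
then factors through `PGL₂(𝔽₅)` (`MonoidHom.liftOfSurjective`), say `χ = φ ∘ proj ρ`; every square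
in `PGL₂(𝔽₅)` is the class of an element of `SL₂(𝔽₅)` (`x² = det(x) · (det(x)⁻¹ x²)`), and `φ`
kills the classes of `SL₂(𝔽₅) = [SL₂(𝔽₅), SL₂(𝔽₅)]` (Mathlib `Matrix.SL2.commutator_eq_top` with
`a = 2`, `a² ≠ 1`; `Abelianization.commutator_subset_ker`), so `φ(x)² = 1` for all `x`.  The
group-theoretic content of "`Gal(F(ζ₅)/F)` would be an abelian quotient of `PGL₂(𝔽₅) ≅ S₅`, of
order `≤ 2`" behind the printed gloss "This condition holds if `[F(ζ₅) : F] = 4`".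
[cite: KisinModuli2009, (3.2.3)(3) (gloss "This condition holds if [F(ζ₅):F] = 4")] -/
theorem sq_eq_one_of_surjective_of_ker_le {ρ : Γ →* GL (Fin 2) (ZMod 5)}
    (hs : Function.Surjective (Matrix.ProjGenLinGroup.mk.comp ρ)) {χ : Γ →* (ZMod 5)ˣ}
    (hker : ∀ γ : Γ, Matrix.ProjGenLinGroup.mk (ρ γ) = 1 → χ γ = 1) (γ : Γ) : χ γ ^ 2 = 1 := by
  -- `χ` factors through `proj ρ`
  have hle : (Matrix.ProjGenLinGroup.mk.comp ρ).ker ≤ χ.ker := fun δ hδ => by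
    rw [MonoidHom.mem_ker] at hδ ⊢
    exact hker δ hδ
  set φ : PGL(2, ZMod 5) →* (ZMod 5)ˣ :=
    (Matrix.ProjGenLinGroup.mk.comp ρ).liftOfSurjective hs ⟨χ, hle⟩ with hφ
  have hφχ : ∀ δ : Γ, φ (Matrix.ProjGenLinGroup.mk (ρ δ)) = χ δ := fun δ => by
    have := (Matrix.ProjGenLinGroup.mk.comp ρ).liftOfRightInverse_comp_apply
      (Function.surjInv hs) (Function.rightInverse_surjInv hs) ⟨χ, hle⟩ δ
    simpa only [MonoidHom.comp_apply] using this
  -- `φ` kills the classes of `SL₂(𝔽₅)`, which is perfect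
  have hSL : ∀ s : SL(2, ZMod 5),
      φ (Matrix.ProjGenLinGroup.mk (Matrix.SpecialLinearGroup.toGL s)) = 1 := by
    intro s
    have hs' : s ∈ commutator SL(2, ZMod 5) := by
      rw [Matrix.SL2.commutator_eq_top (by decide : (2 : ZMod 5) ≠ 0)
        (by decide : (2 : ZMod 5) ^ 2 ≠ 1)]
      exact Subgroup.mem_top s
    have := Abelianization.commutator_subset_ker
      (φ.comp (Matrix.ProjGenLinGroup.mk.comp Matrix.SpecialLinearGroup.toGL)) hs'
    simpa only [MonoidHom.mem_ker, MonoidHom.comp_apply] using this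
  -- `ρ(γ)² = det ρ(γ) · s` with `s ∈ SL₂(𝔽₅)`
  set g : GL (Fin 2) (ZMod 5) := ρ γ with hg
  set d : (ZMod 5)ˣ := Matrix.GeneralLinearGroup.det g with hd
  have hsdet : ((Matrix.GeneralLinearGroup.scalar (Fin 2) d⁻¹ * g ^ 2 : GL (Fin 2) (ZMod 5)) :
      Matrix (Fin 2) (Fin 2) (ZMod 5)).det = 1 := by
    rw [← Matrix.GeneralLinearGroup.val_det_apply, map_mul, map_pow,
      Matrix.GeneralLinearGroup.det_scalar, Fintype.card_fin, ← hd, inv_pow, inv_mul_cancel,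
      Units.val_one]
  set s : SL(2, ZMod 5) :=
    ⟨((Matrix.GeneralLinearGroup.scalar (Fin 2) d⁻¹ * g ^ 2 : GL (Fin 2) (ZMod 5)) :
      Matrix (Fin 2) (Fin 2) (ZMod 5)), hsdet⟩ with hsdef
  have hsG : Matrix.SpecialLinearGroup.toGL s = Matrix.GeneralLinearGroup.scalar (Fin 2) d⁻¹ * g ^ 2 :=
    Units.ext rfl
  have hsq : Matrix.ProjGenLinGroup.mk g ^ 2 =
      Matrix.ProjGenLinGroup.mk (Matrix.SpecialLinearGroup.toGL s) := by
    rw [hsG, map_mul, Matrix.ProjGenLinGroup.mk_scalar, one_mul, map_pow]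
  -- conclude
  calc χ γ ^ 2 = φ (Matrix.ProjGenLinGroup.mk g) ^ 2 := by rw [hg, hφχ]
    _ = φ (Matrix.ProjGenLinGroup.mk (Matrix.SpecialLinearGroup.toGL s)) := by rw [← map_pow, hsq]
    _ = 1 := hSL s

/-- **Kisin 2009, the gloss on (3.2.3)(3): "This condition holds if `[F(ζ₅) : F] = 4`"**, group
form, PROVED: if `χ : Γ → 𝔽₅ˣ` is onto (for `χ = χ̄₅`: `Gal(F(ζ₅)/F) ≅ 𝔽₅ˣ`, i.e.
`[F(ζ₅) : F] = 4`), then hypothesis (3.2.3)(3) holds for every `ρ : Γ → GL₂(𝔽₅)` — were the kernel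
of an onto `proj ρ` inside `ker χ`, every value of `χ` would square to `1`
(`sq_eq_one_of_surjective_of_ker_le`), but `2² = 4 ≠ 1`.  (The source states the gloss without
proof.) [cite: KisinModuli2009, (3.2.3)(3) ("This condition holds if [F(ζ₅):F] = 4")] -/
theorem taylorWilesHypothesisFive_of_surjective (ρ : Γ →* GL (Fin 2) (ZMod 5))
    {χ : Γ →* (ZMod 5)ˣ} (hχ : Function.Surjective χ) : TaylorWilesHypothesisFive ρ χ := by
  intro hs
  by_contra hno
  push Not at hno
  obtain ⟨γ, hγ⟩ := hχ twoUnit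
  have h := sq_eq_one_of_surjective_of_ker_le hs hno γ
  rw [hγ] at h
  exact twoUnit_sq_ne_one h

end Kisin2009

/-! ### `√5 ∈ K`: the mod-`5` cyclotomic character takes values in `{±1}` -/

section SqrtFive

universe u

variable (K : Type u) [Field K] [CharZero K]

/-- **`√5 ∈ K` ⇒ `χ̄₅² = 1` on `Γ_K`** (Freitas–Le Hung–Siksek 2015, Remark (iii) after Cor. 2.1:
"let `K = ℚ(√5)` […] `det(G) = χ₅(Gal(ℚ(ζ₅)/ℚ(√5))) = {1̄, 4̄} ⊂ 𝔽₅^*`", here for any field of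
characteristic `0` in which `5` is a square).  Proof: for a primitive fifth root of unity `ζ ∈ K̄`
the Gauss sum `g = ζ + ζ⁴ − ζ² − ζ³` has `g² = 5 = x²` (`x² = 5` in `K`), so `g = ±x ∈ K` is fixed
by every `σ ∈ Γ_K`; but `σ ζ = ζ^{χ̄₅(σ)}` and for `χ̄₅(σ) ∈ {2, 3}` one computes `σ g = −g ≠ g`
(`g ≠ 0`).  Hence `χ̄₅(σ) ∈ {1, 4}`, i.e. `χ̄₅(σ)² = 1`.  Converse companion of the tree's
`modPCyclotomicCharacterZMod_five_surjective` (`√5 ∉ K` ⇒ `χ̄₅` onto).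
[cite: FreitasLeHungSiksek2015, Remark (iii) after Cor. 2.1 (p. 20 of arXiv:1310.7088)] -/
theorem modPCyclotomicCharacterZMod_five_sq_eq_one_of_isSquare [Fact (Nat.Prime 5)]
    (h5 : IsSquare (5 : K)) (σ : absoluteGaloisGroup K) :
    modPCyclotomicCharacterZMod K 5 σ ^ 2 = 1 := by
  haveI : NeZero ((5 : ℕ) : K) := NeZero.charZero
  obtain ⟨x, hx⟩ := h5
  obtain ⟨ζ, hζ⟩ := HasEnoughRootsOfUnity.exists_primitiveRoot (AlgebraicClosure K) 5
  have h1 : ζ ^ 5 = 1 := hζ.pow_eq_one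
  have hΦ : 1 + ζ + ζ ^ 2 + ζ ^ 3 + ζ ^ 4 = 0 := by
    have := hζ.geom_sum_eq_zero (by norm_num : 1 < 5)
    simp only [Finset.sum_range_succ, Finset.sum_range_zero, zero_add, pow_zero, pow_one] at this
    exact this
  -- the Gauss sum and its square
  set g : AlgebraicClosure K := ζ + ζ ^ 4 - ζ ^ 2 - ζ ^ 3 with hg
  have hg2 : g ^ 2 = 5 := by
    simp only [hg]
    linear_combination (ζ ^ 4 - 3 * ζ ^ 3 + ζ ^ 2 + 5 * ζ - 5) * hΦ
  -- `g = ± x`, hence fixed by `Γ_K`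
  set x' : AlgebraicClosure K := algebraMap K (AlgebraicClosure K) x with hx'
  have hx2 : x' ^ 2 = 5 := by
    rw [hx', ← map_pow, sq, ← hx, map_ofNat]
  have hgx : g = x' ∨ g = -x' := by
    have h0 : (g - x') * (g + x') = 0 := by linear_combination hg2 - hx2
    rcases mul_eq_zero.mp h0 with h | h
    · exact Or.inl (sub_eq_zero.mp h)
    · exact Or.inr (eq_neg_of_add_eq_zero_left h)
  have hfixx : σ • x' = x' := by
    rw [hx', absoluteGaloisGroup.smul_def, AlgEquiv.commutes]
  have hfix : σ • g = g := by
    rcases hgx with h | h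
    · rw [h, hfixx]
    · rw [h, smul_neg, hfixx]
  -- `σ ζ = ζ ^ n`, `n = χ̄₅(σ) ∈ {1, 2, 3, 4}`
  set n : ℕ := ((modPCyclotomicCharacterZMod K 5 σ : (ZMod 5)ˣ) : ZMod 5).val with hn
  have hsmul : σ • ζ = ζ ^ n := modPCyclotomicCharacterZMod_spec K 5 σ ζ h1
  have hn5 : n < 5 := ZMod.val_lt _
  have hn0 : n ≠ 0 := by
    rw [hn]
    exact (ZMod.val_ne_zero _).mpr (modPCyclotomicCharacterZMod K 5 σ).ne_zero
  have hσg : σ • g = ζ ^ n + (ζ ^ n) ^ 4 - (ζ ^ n) ^ 2 - (ζ ^ n) ^ 3 := by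
    simp only [hg, smul_sub, smul_add, smul_pow', hsmul]
  have h5ne : (5 : AlgebraicClosure K) ≠ 0 := by
    rw [← map_ofNat (algebraMap K (AlgebraicClosure K)) 5]
    exact (map_ne_zero _).mpr (by norm_num)
  have h2ne : (2 : AlgebraicClosure K) ≠ 0 := by
    rw [← map_ofNat (algebraMap K (AlgebraicClosure K)) 2]
    exact (map_ne_zero _).mpr (by norm_num)
  have hg0 : g ≠ 0 := by
    intro h0
    rw [h0, zero_pow two_ne_zero] at hg2
    exact h5ne hg2.symm
  -- the key: `χ̄₅(σ)` as an element of `ZMod 5` is `n`, and `n ∈ {1, 4}`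
  have hval : ((modPCyclotomicCharacterZMod K 5 σ : (ZMod 5)ˣ) : ZMod 5) = (n : ZMod 5) := by
    rw [hn, ZMod.natCast_zmod_val]
  have key : (n : ZMod 5) ^ 2 = 1 := by
    interval_cases n
    · exact absurd rfl hn0
    · exact Kisin2009.natCast_sq_eq_one_zmod5.1
    · -- `n = 2`: `σ g = -g`
      exfalso
      have : σ • g = -g := by
        rw [hσg, hg]
        linear_combination (ζ ^ 3 - ζ) * h1
      rw [hfix] at this
      have h2g : (2 : AlgebraicClosure K) * g = 0 := by linear_combination this
      rcases mul_eq_zero.mp h2g with h | h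
      · exact h2ne h
      · exact hg0 h
    · -- `n = 3`: `σ g = -g`
      exfalso
      have : σ • g = -g := by
        rw [hσg, hg]
        linear_combination (ζ ^ 7 + ζ ^ 2 - ζ - ζ ^ 4) * h1
      rw [hfix] at this
      have h2g : (2 : AlgebraicClosure K) * g = 0 := by linear_combination this
      rcases mul_eq_zero.mp h2g with h | h
      · exact h2ne h
      · exact hg0 h
    · exact Kisin2009.natCast_sq_eq_one_zmod5.2
  exact Units.ext (by rw [Units.val_pow_eq_pow_val, hval, key, Units.val_one])

/-- `χ̄₅(σ) = 1` or `χ̄₅(σ) = -1` when `√5 ∈ K` (the printed form "`det(G) = {1̄, 4̄}`").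
[cite: FreitasLeHungSiksek2015, Remark (iii) after Cor. 2.1] -/
theorem modPCyclotomicCharacterZMod_five_eq_one_or_eq_neg_one_of_isSquare [Fact (Nat.Prime 5)]
    (h5 : IsSquare (5 : K)) (σ : absoluteGaloisGroup K) :
    modPCyclotomicCharacterZMod K 5 σ = 1 ∨ modPCyclotomicCharacterZMod K 5 σ = -1 := by
  exact Kisin2009.units_zmod5_eq_or_eq_neg_of_sq_eq_one _
    (modPCyclotomicCharacterZMod_five_sq_eq_one_of_isSquare K h5 σ)

end SqrtFive

/-! ### Elliptic curves over `K ∋ √5`: `det ρ̄_{E,5} = ±1`, the projective image is proper, and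
Kisin's hypothesis holds for every framing -/

section EllipticCurves

universe u

variable {K : Type u} [Field K] [NumberField K]

/-- **Freitas–Le Hung–Siksek 2015, Remark (iii) after Cor. 2.1, for any `K ∋ √5`**: for an elliptic
curve `E / K` (`K` a number field with `√5 ∈ K`) and any framing `ρ̄` of the Galois action on
`E[5]` (`WeierstrassCurve.IsTorsionGaloisRep`), `det ρ̄(σ)² = 1`, i.e. `det ρ̄(σ) = ±1`, for every
`σ ∈ Γ_K` — since `det ρ̄ = χ̄₅` (Weil pairing; tree theorem
`WeierstrassCurve.det_eq_modPCyclotomicCharacter_of_isTorsionGaloisRep_holds`) and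
`χ̄₅(Γ_K) ⊆ {±1}` (`modPCyclotomicCharacterZMod_five_sq_eq_one_of_isSquare`).  This is the input
"`det(G) = {1̄, 4̄}`" of the route `Langlands/SqrtFiveQuarticCovers` (census of the subgroups of
`{det = ±1} ⊆ GL₂(𝔽₅)`). [cite: FreitasLeHungSiksek2015, Remark (iii) after Cor. 2.1] -/
theorem det_sq_eq_one_of_isTorsionGaloisRep_of_isSquare_five [Fact (Nat.Prime 5)]
    (h5 : IsSquare (5 : K)) (E : WeierstrassCurve K) [E.IsElliptic]
    {ρ : FramedGaloisRep K (ZMod 5) 2} (hρ : E.IsTorsionGaloisRep 5 ρ) (σ : absoluteGaloisGroup K) :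
    Matrix.GeneralLinearGroup.det (ρ σ) ^ 2 = 1 := by
  haveI : NeZero ((5 : ℕ) : K) := NeZero.charZero
  rw [E.det_eq_modPCyclotomicCharacter_of_isTorsionGaloisRep_holds 5 ρ hρ σ]
  exact modPCyclotomicCharacterZMod_five_sq_eq_one_of_isSquare K h5 σ

/-- Same, in the form `det ρ̄(σ) = 1 ∨ det ρ̄(σ) = -1` used by the route statements
(`GroupCensusFive`: "`det(G) ⊆ {±1}`"). [cite: FreitasLeHungSiksek2015, Remark (iii) after Cor. 2.1] -/
theorem det_eq_one_or_eq_neg_one_of_isTorsionGaloisRep_of_isSquare_five [Fact (Nat.Prime 5)]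
    (h5 : IsSquare (5 : K)) (E : WeierstrassCurve K) [E.IsElliptic]
    {ρ : FramedGaloisRep K (ZMod 5) 2} (hρ : E.IsTorsionGaloisRep 5 ρ) (σ : absoluteGaloisGroup K) :
    Matrix.det ((ρ σ : GL (Fin 2) (ZMod 5)) : Matrix (Fin 2) (Fin 2) (ZMod 5)) = 1 ∨
      Matrix.det ((ρ σ : GL (Fin 2) (ZMod 5)) : Matrix (Fin 2) (Fin 2) (ZMod 5)) = -1 := by
  rcases Kisin2009.units_zmod5_val_eq_or_eq_neg_of_sq_eq_one _
    (det_sq_eq_one_of_isTorsionGaloisRep_of_isSquare_five h5 E hρ σ) with h1 | h1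
  · exact Or.inl (by rw [← Matrix.GeneralLinearGroup.val_det_apply, h1])
  · exact Or.inr (by rw [← Matrix.GeneralLinearGroup.val_det_apply, h1])

namespace Kisin2009

/-- **Kisin's hypothesis (3.2.3)(3) for a mod-`5` Galois representation of a number field `K`**:
the group form `TaylorWilesHypothesisFive` with `Γ = Γ_K` and `χ = χ̄₅` the mod-`5` cyclotomic
character (`modPCyclotomicCharacterZMod K 5`; "the kernel of `proj ρ̄` fixes `K(ζ₅)`" ⟺ it lies in
`ker χ̄₅`). [cite: KisinModuli2009, (3.2.3)(3) and Thms. (3.5.5)(3), (3.5.7)(4)] -/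
def hypothesisFive (K : Type u) [Field K] [NumberField K] (ρ : FramedGaloisRep K (ZMod 5) 2) : Prop :=
  letI : Fact (Nat.Prime 5) := ⟨by norm_num⟩
  letI : NeZero ((5 : ℕ) : K) := NeZero.charZero
  TaylorWilesHypothesisFive ρ.toMonoidHom (modPCyclotomicCharacterZMod K 5)

/-- Unfolding lemma for `hypothesisFive` (the definition, restated on `Γ_K` and `χ̄₅`).
[cite: KisinModuli2009, (3.2.3)(3)] -/
theorem hypothesisFive_iff [Fact (Nat.Prime 5)] (ρ : FramedGaloisRep K (ZMod 5) 2) :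
    hypothesisFive K ρ ↔
      (Function.Surjective (Matrix.ProjGenLinGroup.mk.comp ρ.toMonoidHom) →
        ∃ σ : absoluteGaloisGroup K, Matrix.ProjGenLinGroup.mk (ρ σ) = 1 ∧
          modPCyclotomicCharacterZMod K 5 σ ≠ 1) := by
  unfold hypothesisFive TaylorWilesHypothesisFive
  exact Iff.rfl

/-- **Kisin's gloss for `χ̄₅`: if `[K(ζ₅) : K] = 4` (`χ̄₅` onto) the hypothesis holds** — e.g. for
every totally real `K` with `√5 ∉ K` (`modPCyclotomicCharacterZMod_five_surjective`).
[cite: KisinModuli2009, (3.2.3)(3) ("This condition holds if [F(ζ₅):F] = 4")] -/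
theorem hypothesisFive_of_surjective [Fact (Nat.Prime 5)] (ρ : FramedGaloisRep K (ZMod 5) 2)
    (hK : Function.Surjective (modPCyclotomicCharacterZMod K 5)) : hypothesisFive K ρ := by
  rw [hypothesisFive_iff]
  exact taylorWilesHypothesisFive_of_surjective ρ.toMonoidHom hK

/-- **Over `K ∋ √5` the projective image of `ρ̄_{E,5}` is never all of `PGL₂(𝔽₅)`.**  For an
elliptic curve `E / K`, `√5 ∈ K`, and any framing `ρ̄` of `E[5]`: `det ρ̄ = χ̄₅` takes only the
square values `±1` (`det_sq_eq_one_of_isTorsionGaloisRep_of_isSquare_five`; `−1 = 2²`), so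
`proj ρ̄` misses the class of `diag(2, 1)` (`not_surjective_proj_of_isSquare_det`): the projective
image lies in the image `PSL₂(𝔽₅)` of the square-determinant matrices.  The referee gate's
"Kisin's `p = 5` caveat cannot bite any `5`-image over `K ∋ √5`" (pub/gate-quartmod, 2026-08-25),
as a theorem; cf. Freitas–Le Hung–Siksek, §2: "then `√5 ∈ K` because
`det : ρ̄(G_K) → PGL₂(𝔽₅) → 𝔽₅^*/(𝔽₅^*)²` is induced by the cyclotomic character".
[cite: FreitasLeHungSiksek2015, §2 (proof of Thm. 2, p = 5) and Remark (iii) after Cor. 2.1] -/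
theorem not_surjective_proj_of_isTorsionGaloisRep_of_isSquare_five [Fact (Nat.Prime 5)]
    (h5 : IsSquare (5 : K)) (E : WeierstrassCurve K) [E.IsElliptic]
    {ρ : FramedGaloisRep K (ZMod 5) 2} (hρ : E.IsTorsionGaloisRep 5 ρ) :
    ¬ Function.Surjective (Matrix.ProjGenLinGroup.mk.comp ρ.toMonoidHom) := by
  exact not_surjective_proj_of_isSquare_det fun σ =>
    units_zmod5_isSquare_of_sq_eq_one _ (det_sq_eq_one_of_isTorsionGaloisRep_of_isSquare_five h5 E hρ σ)

/-- **Kisin's hypothesis (3.2.3)(3) holds for `ρ̄_{E,5}` of every elliptic curve over every number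
field containing `√5`, in every framing** — vacuously, by
`not_surjective_proj_of_isTorsionGaloisRep_of_isSquare_five`.  Together with
`hypothesisFive_of_surjective` (`√5 ∉ K`, `K` totally real: `χ̄₅` onto) this covers every totally
real `K`; it is the formal content of "no `p = 5` side condition is needed for `ρ̄_{E,5}` over
totally real fields" (Freitas–Le Hung–Siksek 2015, §2 and Thm. 3; `FLS2015_theorem3`).  NOT a
modularity statement. [cite: KisinModuli2009, (3.2.3)(3)] [cite: FreitasLeHungSiksek2015, §2 (proof of Thm. 2, p = 5)] -/
theorem hypothesisFive_of_isSquare_five [Fact (Nat.Prime 5)] (h5 : IsSquare (5 : K))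
    (E : WeierstrassCurve K) [E.IsElliptic] {ρ : FramedGaloisRep K (ZMod 5) 2}
    (hρ : E.IsTorsionGaloisRep 5 ρ) : hypothesisFive K ρ := by
  rw [hypothesisFive_iff]
  exact taylorWilesHypothesisFive_of_not_surjective _
    (not_surjective_proj_of_isTorsionGaloisRep_of_isSquare_five h5 E hρ)

/-- **Every elliptic curve over a totally real field satisfies Kisin's `p = 5` hypothesis (in every
framing of `E[5]`)**: if `√5 ∈ K` by `hypothesisFive_of_isSquare_five`, otherwise `χ̄₅` is onto
(`modPCyclotomicCharacterZMod_five_surjective`, using a real embedding of `K`) and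
`hypothesisFive_of_surjective` applies. [cite: KisinModuli2009, (3.2.3)(3)]
[cite: FreitasLeHungSiksek2015, §2 (proof of Thm. 2, p = 5)] -/
theorem hypothesisFive_of_isTotallyReal [Fact (Nat.Prime 5)] [NumberField.IsTotallyReal K]
    (E : WeierstrassCurve K) [E.IsElliptic] {ρ : FramedGaloisRep K (ZMod 5) 2}
    (hρ : E.IsTorsionGaloisRep 5 ρ) : hypothesisFive K ρ := by
  by_cases h5 : IsSquare (5 : K)
  · exact hypothesisFive_of_isSquare_five h5 E hρ
  · obtain ⟨φ⟩ := FLS2015.exists_realEmbedding K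
    exact hypothesisFive_of_surjective ρ (modPCyclotomicCharacterZMod_five_surjective K φ h5)

end Kisin2009

end EllipticCurves


end Literature.NumberTheory.Automorphic

end
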